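import Literature.AlgebraicGeometry.Motives.AbelianVarietyHondaTate
import HarnessLib

/-!
# Honda–Tate over a PRIME field: every `p`-symmetric Weil `p`-polynomial is a characteristic
# polynomial of Frobenius, with exponent one (van Bommel–Costa–Li–Poonen–Smith 2021, Thm. 2.1 and
# Rem. 2.3, restating Waterhouse 1969, Ch. 2) — statement layer

Let `K = 𝔽_q` and, for an abelian variety `A/K`, let `P_A ∈ ℤ[X]` be the characteristic polynomial of
its Frobenius (`AbelianVariety.IsFrobCharpoly A P`, file `AbelianVarietyHondaTate`).  The companion
files record Weil's Riemann hypothesis (`weilRiemannHypothesis`), the existence half of Honda–Tate up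
to a power (`hondaTateExistence`) and the exponent-one statement for ORDINARY Weil `q`-polynomials
(`hondaTateOrdinary`, Howe 1995 Thm. 3.3).  This file records the one further published statement
that removes the power over a PRIME field, in the POLYNOMIAL form in which the source states it.

Source: R. van Bommel, E. Costa, W. Li, B. Poonen, A. Smith, *Abelian varieties of prescribed order
over finite fields* (2021; Math. Ann.), arXiv:2106.13651 [vanBommelCostaLiPoonenSmith2021PrescribedOrder]
— held (`paper:arxiv-2106.13651`, read), § 2 p. 5, verbatim: "Throughout the paper, if `f` is a
polynomial, then `f^{[i]}` denotes the coefficient of its degree `i` term.  All the results of this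
section are restatements of results in [Waterhouse 1969].  **Theorem 2.1 (Honda–Tate).** A polynomial
`f ∈ ℤ[x]` is the characteristic polynomial of an ordinary abelian variety `A` of dimension `n` over
`𝔽_q` if and only if (a) `f` is monic of degree `2n`; (b) `f` is `q`-symmetric, by which we mean
`f^{[i]} = q^{n-i} f^{[2n-i]}` for `i = 0, …, n-1`; (c) all complex roots of `f` have absolute value
`q^{1/2}`; and (d) `p ∤ f^{[n]}`. […] **Remark 2.3.** Let `v : ℚ_p → ℤ ∪ {∞}` be the `p`-adic
valuation.  If in Theorem 2.1 we replace (d) by the weaker condition (d') the multiplicity `μ` of each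
`ℚ_p`-irreducible factor `g` in `f` is such that `μ v(g(0))/v(q) ∈ ℤ`, then we obtain the criterion
for `f` to be the characteristic polynomial of a not-necessarily-ordinary abelian variety `A` of
dimension `n` over `𝔽_q`.  If `q` is prime, then (d') holds automatically."

* `IsSymmetricWeilPoly q n f` — conditions (a), (b), (c) of Theorem 2.1 for the pair `(q, n)`,
  recorded literally (a DEFINITION on integer polynomials).
* `AbelianVariety.hondaTatePrimeField K` — NAMED FACT (D-0014: `def … : Prop`, used as an explicit
  hypothesis `(hP : hondaTatePrimeField K)`, never asserted): the "if" direction of the criterion of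
  Remark 2.3 in the case `q = #K` PRIME, where (d') is automatic — every `f` satisfying (a), (b), (c)
  for `(q, n)`, `n ≥ 1`, is the characteristic polynomial of the Frobenius of an abelian variety of
  dimension `n` over `K`, with exponent ONE (contrast `hondaTateExistence`: a power; `hondaTateOrdinary`:
  exponent one but only for `p ∤ f^{[n]}`).  The "only if" direction ((a): `IsFrobCharpoly.monic`,
  degree `2 dim`; (c): `weilRiemannHypothesis`; (b): the functional equation of `P_A`) is NOT recorded
  here.  Consistent account: Waterhouse 1969 [Waterhouse1969], Ch. 2, pp. 527–528 (the invariants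
  `inv_v(E) = ord_v(π) [ℚ(π)_v : ℚ_p] / ord_v(q)`; for `q = p` they are integers, so the period `e` of a
  Weil `p`-number without real conjugate is `1`, and `π = ± p^{1/2}` gives `(x² - p)²`).  Not proved in
  the tree (Honda–Tate plus the local invariants of `End⁰ A`); used as the hypothesis
  `(hP : AbelianVariety.hondaTatePrimeField K)`.

## What is PROVED here (no further input)

Projections of the definition and the reformulation `isSymmetricWeilPoly_iff`.

## Deliberately NOT here

The "only if" direction; the general criterion (d') for prime powers (needs `ℚ_p`-factorisations);
the ordinary case (file `AbelianVarietyHondaTateOrdinary`).  No `_holds` theorem: the fact rests on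
Honda–Tate (`hondaTateExistence` is itself a named fact).

## References

* [vanBommelCostaLiPoonenSmith2021PrescribedOrder] R. van Bommel, E. Costa, W. Li, B. Poonen,
  A. Smith, *Abelian varieties of prescribed order over finite fields*, arXiv:2106.13651 (2021),
  Math. Ann.: § 2, Theorem 2.1, Remarks 2.2–2.3, p. 5.  Held, read.
* [Waterhouse1969] W. C. Waterhouse, *Abelian varieties over finite fields*, Ann. sci. ÉNS (4) 2
  (1969), Ch. 2, pp. 527–528.  Held, read.
-/

open Polynomial

universe u

namespace Literature.AlgebraicGeometry.Motives

/-! ## Symmetric Weil `q`-polynomials of dimension `n` (vBCLPS 2021, Thm. 2.1 (a)–(c)) -/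

/-- **Conditions (a), (b), (c) of van Bommel–Costa–Li–Poonen–Smith 2021, Theorem 2.1** (p. 5,
verbatim: "(a) `f` is monic of degree `2n`; (b) `f` is `q`-symmetric, by which we mean
`f^{[i]} = q^{n-i} f^{[2n-i]}` for `i = 0, …, n-1`; (c) all complex roots of `f` have absolute value
`q^{1/2}`", `f^{[i]}` being "the coefficient of its degree `i` term").  Recorded literally, for
arbitrary naturals `q`, `n`.
[cite: vanBommelCostaLiPoonenSmith2021PrescribedOrder, Theorem 2.1 (a)–(c), p. 5] -/
def IsSymmetricWeilPoly (q n : ℕ) (f : ℤ[X]) : Prop :=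
  (f.Monic ∧ f.natDegree = 2 * n) ∧
    (∀ i, i < n → f.coeff i = (q : ℤ) ^ (n - i) * f.coeff (2 * n - i)) ∧
    ∀ α ∈ (f.map (Int.castRingHom ℂ)).roots, ‖α‖ = Real.sqrt q

namespace IsSymmetricWeilPoly

variable {q n : ℕ} {f : ℤ[X]}

/-- (a): monic. [cite: vanBommelCostaLiPoonenSmith2021PrescribedOrder, Theorem 2.1 (a), p. 5] -/
theorem monic (hf : IsSymmetricWeilPoly q n f) : f.Monic := hf.1.1

/-- (a): degree `2n`. [cite: vanBommelCostaLiPoonenSmith2021PrescribedOrder, Theorem 2.1 (a), p. 5] -/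
theorem natDegree_eq (hf : IsSymmetricWeilPoly q n f) : f.natDegree = 2 * n := hf.1.2

/-- (b): `q`-symmetry. [cite: vanBommelCostaLiPoonenSmith2021PrescribedOrder, Theorem 2.1 (b), p. 5] -/
theorem symm (hf : IsSymmetricWeilPoly q n f) :
    ∀ i, i < n → f.coeff i = (q : ℤ) ^ (n - i) * f.coeff (2 * n - i) := hf.2.1

/-- (c): all complex roots have absolute value `q^{1/2}`.
[cite: vanBommelCostaLiPoonenSmith2021PrescribedOrder, Theorem 2.1 (c), p. 5] -/
theorem rh (hf : IsSymmetricWeilPoly q n f) :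
    ∀ α ∈ (f.map (Int.castRingHom ℂ)).roots, ‖α‖ = Real.sqrt q := hf.2.2

end IsSymmetricWeilPoly

/-- Unfolding. [cite: vanBommelCostaLiPoonenSmith2021PrescribedOrder, Theorem 2.1 (a)–(c), p. 5] -/
theorem isSymmetricWeilPoly_iff {q n : ℕ} {f : ℤ[X]} :
    IsSymmetricWeilPoly q n f ↔
      (f.Monic ∧ f.natDegree = 2 * n) ∧
        (∀ i, i < n → f.coeff i = (q : ℤ) ^ (n - i) * f.coeff (2 * n - i)) ∧
        ∀ α ∈ (f.map (Int.castRingHom ℂ)).roots, ‖α‖ = Real.sqrt q :=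
  Iff.rfl

/-! ## The named fact -/

namespace AbelianVariety

variable {K : Type u} [Field K] [Finite K]

variable (K) in
/-- **NAMED FACT — Honda–Tate over a prime field, polynomial form, exponent one** (van Bommel–Costa–
Li–Poonen–Smith 2021, § 2 p. 5, "restatements of results in [Waterhouse 1969]": Theorem 2.1
(Honda–Tate) — "A polynomial `f ∈ ℤ[x]` is the characteristic polynomial of an ordinary abelian variety
`A` of dimension `n` over `𝔽_q` if and only if (a) `f` is monic of degree `2n`; (b) `f` is
`q`-symmetric […]; (c) all complex roots of `f` have absolute value `q^{1/2}`; and (d) `p ∤ f^{[n]}`" —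
with Remark 2.3: "If in Theorem 2.1 we replace (d) by the weaker condition (d') […], then we obtain the
criterion for `f` to be the characteristic polynomial of a not-necessarily-ordinary abelian variety `A`
of dimension `n` over `𝔽_q`.  If `q` is prime, then (d') holds automatically.").  POLYNOMIAL FORM
recorded (the "if" direction, prime `q = #K` only): every `f` satisfying (a), (b), (c) for `(#K, n)`,
`n ≥ 1`, is the characteristic polynomial of the Frobenius of an abelian variety of dimension `n` over
`K`.  Not proved in the tree (Honda–Tate and the local invariants of `End⁰ A`, Waterhouse 1969 Ch. 2,
pp. 527–528); used as the hypothesis `(hP : AbelianVariety.hondaTatePrimeField K)`.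
[cite: vanBommelCostaLiPoonenSmith2021PrescribedOrder, Theorem 2.1 and Remark 2.3, p. 5]
[cite: Waterhouse1969, Ch. 2, pp. 527–528] -/
def hondaTatePrimeField : Prop :=
  (Nat.card K).Prime → ∀ (n : ℕ) (f : ℤ[X]), 0 < n → IsSymmetricWeilPoly (Nat.card K) n f →
    ∃ A : AbelianVariety K, A.dim = n ∧ A.IsFrobCharpoly f

end AbelianVariety

end Literature.AlgebraicGeometry.Motives
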